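import Mathlib
import HarnessLib

/-!
# Linear algebra for the Brascamp–Lieb induction: the variational bound for `vᵀ M⁻¹ v`

`Literature/Probability/Distributions/`. Elementary facts about a real positive definite matrix
`M` used in the cube-induction proof of the Brascamp–Lieb variance inequality
(`BrascampLieb1976_thm41`, file `BrascampLieb`):

* `two_mul_dotProduct_sub_le_inv_quadForm`: `2 v·w − wᵀ M w ≤ vᵀ M⁻¹ v` for all `w`
  (complete the square), so the inverse quadratic form is a supremum of affine-quadratic
  expressions and can be bounded below by any test vector — this replaces block-inverse /
  Schur-complement formulas in the inductive step;
* `cons_dotProduct_mulVec_cons`: block expansion of `wᵀ M w` along `Fin.cons`;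
* `schur_scalar_pos`: `M₀₀ − bᵀ D⁻¹ b > 0` (`D` the lower-right block, `b` the off-diagonal row);
* `fibre_test_bound`: the bound at the test vector `w = (t, D⁻¹(v' − t b))`,
  `2 t v₀ − t² M₀₀ + (v' − t b)ᵀ D⁻¹ (v' − t b) ≤ vᵀ M⁻¹ v`;
* `continuous_matrix_inv_of_det_ne_zero`: continuity of `x ↦ (M x)⁻¹`.

All folklore; no definitions.
-/

noncomputable section

open Matrix

namespace Literature.Probability.Distributions


variable {k : Type*} [Fintype k] [DecidableEq k]

/-- For a real positive definite matrix `M` (symmetric), `(M⁻¹ v) ⬝ (M w) = v ⬝ w`. [folklore] -/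
theorem inv_mulVec_dotProduct_mulVec {M : Matrix k k ℝ} (hM : M.PosDef) (v w : k → ℝ) :
    (M⁻¹ *ᵥ v) ⬝ᵥ (M *ᵥ w) = v ⬝ᵥ w := by
  have hsymm : Mᵀ = M := by
    have := hM.isHermitian.eq
    rwa [conjTranspose_eq_transpose_of_trivial] at this
  have hdet : IsUnit M.det := (isUnit_iff_isUnit_det M).1 hM.isUnit
  rw [dotProduct_mulVec, ← mulVec_transpose, hsymm, mulVec_mulVec, mul_nonsing_inv M hdet,
    one_mulVec]

/-- **Variational bound for the inverse quadratic form**: for a real positive definite `M` and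
all `v w`, `2 (v ⬝ w) − w ⬝ M w ≤ v ⬝ M⁻¹ v` (complete the square:
the difference is `(w − M⁻¹v) ⬝ M (w − M⁻¹v) ≥ 0`). [folklore] -/
theorem two_mul_dotProduct_sub_le_inv_quadForm {M : Matrix k k ℝ} (hM : M.PosDef) (v w : k → ℝ) :
    2 * (v ⬝ᵥ w) - w ⬝ᵥ (M *ᵥ w) ≤ v ⬝ᵥ (M⁻¹ *ᵥ v) := by
  have h0 : 0 ≤ (w - M⁻¹ *ᵥ v) ⬝ᵥ (M *ᵥ (w - M⁻¹ *ᵥ v)) := by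
    have := hM.posSemidef.dotProduct_mulVec_nonneg (w - M⁻¹ *ᵥ v)
    simpa using this
  have h1 : (M⁻¹ *ᵥ v) ⬝ᵥ (M *ᵥ w) = v ⬝ᵥ w := inv_mulVec_dotProduct_mulVec hM v w
  have h2 : w ⬝ᵥ (M *ᵥ (M⁻¹ *ᵥ v)) = v ⬝ᵥ w := by
    have hdet : IsUnit M.det := (isUnit_iff_isUnit_det M).1 hM.isUnit
    rw [mulVec_mulVec, mul_nonsing_inv M hdet, one_mulVec, dotProduct_comm]
  have h3 : (M⁻¹ *ᵥ v) ⬝ᵥ (M *ᵥ (M⁻¹ *ᵥ v)) = v ⬝ᵥ (M⁻¹ *ᵥ v) :=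
    inv_mulVec_dotProduct_mulVec hM v _
  rw [mulVec_sub, sub_dotProduct, dotProduct_sub, dotProduct_sub, h1, h2, h3] at h0
  linarith

/-- The inverse quadratic form of a real positive definite matrix is nonnegative. [folklore] -/
theorem inv_quadForm_nonneg {M : Matrix k k ℝ} (hM : M.PosDef) (v : k → ℝ) :
    0 ≤ v ⬝ᵥ (M⁻¹ *ᵥ v) := by
  have := two_mul_dotProduct_sub_le_inv_quadForm hM v 0
  simpa using this

/-- Block expansion of the quadratic form of a symmetric matrix indexed by `Fin (m+1)` along
`Fin.cons`: `(t, w)ᵀ M (t, w) = t² M₀₀ + 2t ∑ᵢ M₀ᵢ' wᵢ + wᵀ D w`, `D` the lower-right block.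
[folklore] -/
theorem cons_dotProduct_mulVec_cons {m : ℕ} (M : Matrix (Fin (m + 1)) (Fin (m + 1)) ℝ)
    (hM : Mᵀ = M) (t : ℝ) (w : Fin m → ℝ) :
    (Fin.cons t w : Fin (m + 1) → ℝ) ⬝ᵥ (M *ᵥ Fin.cons t w) =
      t ^ 2 * M 0 0 + 2 * t * ∑ i, M 0 (Fin.succ i) * w i +
        w ⬝ᵥ (M.submatrix Fin.succ Fin.succ *ᵥ w) := by
  have hs : ∀ i : Fin m, M (Fin.succ i) 0 = M 0 (Fin.succ i) := fun i =>
    calc M (Fin.succ i) 0 = Mᵀ 0 (Fin.succ i) := rfl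
      _ = M 0 (Fin.succ i) := by rw [hM]
  simp only [dotProduct, mulVec, Fin.sum_univ_succ, Fin.cons_zero, Fin.cons_succ,
    submatrix_apply, hs]
  have e1 : ∑ i : Fin m, w i * (M 0 i.succ * t + ∑ j : Fin m, M i.succ j.succ * w j) =
      t * ∑ i, M 0 i.succ * w i + ∑ i : Fin m, w i * ∑ j : Fin m, M i.succ j.succ * w j := by
    rw [Finset.mul_sum, ← Finset.sum_add_distrib]
    exact Finset.sum_congr rfl fun i _ => by ring
  rw [e1]
  ring

/-- The Schur-complement scalar of a real positive definite matrix indexed by `Fin (m+1)` is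
positive: `M₀₀ − bᵀ D⁻¹ b > 0` with `b = (M₀ᵢ')ᵢ`, `D` the lower-right block. [folklore] -/
theorem schur_scalar_pos {m : ℕ} {M : Matrix (Fin (m + 1)) (Fin (m + 1)) ℝ} (hM : M.PosDef) :
    0 < M 0 0 - (fun i => M 0 (Fin.succ i)) ⬝ᵥ
      ((M.submatrix Fin.succ Fin.succ)⁻¹ *ᵥ fun i => M 0 (Fin.succ i)) := by
  set D := M.submatrix Fin.succ Fin.succ with hD
  set b : Fin m → ℝ := fun i => M 0 (Fin.succ i) with hb
  have hDpd : D.PosDef := hM.submatrix (Fin.succ_injective m)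
  have hsymm : Mᵀ = M := by
    have := hM.isHermitian.eq
    rwa [conjTranspose_eq_transpose_of_trivial] at this
  have hx : (Fin.cons 1 (-(D⁻¹ *ᵥ b)) : Fin (m + 1) → ℝ) ≠ 0 := by
    intro h
    have := congrFun h 0
    simp at this
  have hpos := hM.dotProduct_mulVec_pos hx
  rw [star_trivial, cons_dotProduct_mulVec_cons M hsymm] at hpos
  have h1 : (-(D⁻¹ *ᵥ b)) ⬝ᵥ (D *ᵥ (-(D⁻¹ *ᵥ b))) = b ⬝ᵥ (D⁻¹ *ᵥ b) := by
    rw [mulVec_neg, neg_dotProduct, dotProduct_neg, neg_neg, inv_mulVec_dotProduct_mulVec hDpd,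
      dotProduct_comm]
  have h2 : ∑ i, M 0 (Fin.succ i) * (-(D⁻¹ *ᵥ b)) i = -(b ⬝ᵥ (D⁻¹ *ᵥ b)) := by
    simp only [Pi.neg_apply, mul_neg, Finset.sum_neg_distrib, dotProduct, hb]
  rw [h1, h2] at hpos
  linarith

/-- The value of the test vector `w = (t, D⁻¹(v' − t b))` in the variational bound:
`2 v⬝w − wᵀMw = 2 t v₀ − t² M₀₀ + (v' − t b)ᵀ D⁻¹ (v' − t b)`, with `b = (M₀ᵢ')ᵢ`, `v' = (vᵢ')ᵢ`
and `D` the lower-right block. [folklore] -/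
theorem test_vector_value {m : ℕ} {M : Matrix (Fin (m + 1)) (Fin (m + 1)) ℝ} (hM : M.PosDef)
    (v : Fin (m + 1) → ℝ) (t : ℝ) :
    2 * (v ⬝ᵥ (Fin.cons t ((M.submatrix Fin.succ Fin.succ)⁻¹ *ᵥ
        fun i => v (Fin.succ i) - t * M 0 (Fin.succ i)) : Fin (m + 1) → ℝ)) -
      (Fin.cons t ((M.submatrix Fin.succ Fin.succ)⁻¹ *ᵥ
        fun i => v (Fin.succ i) - t * M 0 (Fin.succ i)) : Fin (m + 1) → ℝ) ⬝ᵥ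
        (M *ᵥ (Fin.cons t ((M.submatrix Fin.succ Fin.succ)⁻¹ *ᵥ
          fun i => v (Fin.succ i) - t * M 0 (Fin.succ i)) : Fin (m + 1) → ℝ)) =
      2 * t * v 0 - t ^ 2 * M 0 0 +
        (fun i => v (Fin.succ i) - t * M 0 (Fin.succ i)) ⬝ᵥ
          ((M.submatrix Fin.succ Fin.succ)⁻¹ *ᵥ fun i => v (Fin.succ i) - t * M 0 (Fin.succ i)) := by
  set D := M.submatrix Fin.succ Fin.succ with hD
  set c : Fin m → ℝ := fun i => v (Fin.succ i) - t * M 0 (Fin.succ i) with hc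
  have hDpd : D.PosDef := hM.submatrix (Fin.succ_injective m)
  have hsymm : Mᵀ = M := by
    have := hM.isHermitian.eq
    rwa [conjTranspose_eq_transpose_of_trivial] at this
  rw [cons_dotProduct_mulVec_cons M hsymm]
  have h1 : (D⁻¹ *ᵥ c) ⬝ᵥ (D *ᵥ (D⁻¹ *ᵥ c)) = c ⬝ᵥ (D⁻¹ *ᵥ c) :=
    inv_mulVec_dotProduct_mulVec hDpd c _
  have h2 : v ⬝ᵥ (Fin.cons t (D⁻¹ *ᵥ c) : Fin (m + 1) → ℝ) =
      v 0 * t + ∑ i, v (Fin.succ i) * (D⁻¹ *ᵥ c) i := by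
    simp [dotProduct, Fin.sum_univ_succ]
  have h3 : ∑ i, v (Fin.succ i) * (D⁻¹ *ᵥ c) i =
      c ⬝ᵥ (D⁻¹ *ᵥ c) + t * ∑ i, M 0 (Fin.succ i) * (D⁻¹ *ᵥ c) i := by
    simp only [dotProduct, Finset.mul_sum, ← Finset.sum_add_distrib]
    refine Finset.sum_congr rfl fun i _ => ?_
    simp only [hc]; ring
  rw [h1, h2, h3]
  ring

/-- **The fibre test-vector bound**: for a real positive definite `M` indexed by `Fin (m+1)`,
`2 t v₀ − t² M₀₀ + cᵀ D⁻¹ c ≤ vᵀ M⁻¹ v` where `c = (vᵢ' − t M₀ᵢ')ᵢ` and `D` is the lower-right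
block (the variational bound at `w = (t, D⁻¹ c)`). [folklore] -/
theorem fibre_test_bound {m : ℕ} {M : Matrix (Fin (m + 1)) (Fin (m + 1)) ℝ} (hM : M.PosDef)
    (v : Fin (m + 1) → ℝ) (t : ℝ) :
    2 * t * v 0 - t ^ 2 * M 0 0 +
        (fun i => v (Fin.succ i) - t * M 0 (Fin.succ i)) ⬝ᵥ
          ((M.submatrix Fin.succ Fin.succ)⁻¹ *ᵥ fun i => v (Fin.succ i) - t * M 0 (Fin.succ i)) ≤
      v ⬝ᵥ (M⁻¹ *ᵥ v) := by
  rw [← test_vector_value hM v t]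
  exact two_mul_dotProduct_sub_le_inv_quadForm hM v _

/-- Continuity of `x ↦ (M x)⁻¹` for a continuous family of real matrices with nonvanishing
determinant. [folklore] -/
theorem continuous_matrix_inv_of_det_ne_zero {X : Type*} [TopologicalSpace X]
    {M : X → Matrix k k ℝ} (hM : Continuous M) (hdet : ∀ x, (M x).det ≠ 0) :
    Continuous fun x => (M x)⁻¹ := by
  refine continuous_iff_continuousAt.2 fun x => ?_
  have h : ContinuousAt Ring.inverse (M x).det := by
    rw [Ring.inverse_eq_inv']
    exact continuousAt_inv₀ (hdet x)
  exact (continuousAt_matrix_inv (M x) h).comp hM.continuousAt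

end Literature.Probability.Distributions
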